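import Literature.NumberTheory.Sieve.SmoothPolylogRegimeScales
import HarnessLib

/-!
# Summing crude cell bounds over the non-shallow valuation cells (polylog regime)

Topic `Literature/NumberTheory/Sieve`; a PROVED bookkeeping file (elementary real analysis, no number
theory beyond `log`).  In the polylog regime `y = ⌊(log x)^{100000}⌋`, `x → ∞`, suppose a nonnegative cell
function `cm q v` (think: the proportion of members of a family of `y`-friable `abc`-triples whose
distinguished member is exactly divisible by `q^v`) vanishes for primes `q > y` and for `q^v > x`, and obeys
the crude bound of `ternary_crude_count_two_regimes` (`SmoothTernaryCrudeCountRegimes.lean`) divided by the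
family size, `cm q v ≤ A ((log x)^{24} (q^v)^{-7/12} + x^{-2/5})`, when `q^v ≤ x`.  Then the window-weighted
mass of the NON-SHALLOW cells `q^{v+1} > y⁴` is eventually `≤ e`:
`Σ_{q ∈ T} Σ_{1 ≤ v ≤ V} [q^{v+1} > y⁴] (v+1) log q · cm q v ≤ e` for every finite set `T` of primes `≥ 3` and
every `V` (`valuation_tail_sum_small`).  Ingredients (namespace `ValuationTailSum`): `q^{v+1} > y⁴`, `q ≤ y`
force `q^v > y³`, so `(q^v)^{-7/12} ≤ y^{-3/2} s_q^v` with `s_q = q^{-1/12} ≤ 3^{-1/12} ≤ 11/12` and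
`Σ_v (v+1) s^v ≤ (1−s)^{-2} ≤ 144`; cells with `q^v ≤ x` have `v ≤ log x`; at most `y + 1` primes `q ≤ y`
contribute, each with `log q ≤ log y ≤ 10⁵ log log x`.
-/

noncomputable section

open Finset Filter Real

namespace Literature.NumberTheory.Sieve

namespace ValuationTailSum

/-- `Σ_{1 ≤ v ≤ V} (v+1) s^v ≤ (1−s)^{-2}` for `0 ≤ s < 1` (partial sums of `Σ_{n ≥ 0} (n+1) s^n = (1−s)^{-2}`).
[folklore] -/
theorem sum_Icc_succ_mul_pow_le {s : ℝ} (hs0 : 0 ≤ s) (hs1 : s < 1) (V : ℕ) :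
    ∑ v ∈ Icc 1 V, ((v : ℝ) + 1) * s ^ v ≤ 1 / (1 - s) ^ 2 := by
  have h := hasSum_choose_mul_geometric_of_norm_lt_one 1 (r := s) (by rwa [Real.norm_of_nonneg hs0])
  have := sum_le_hasSum (Icc 1 V) (fun i _ => ?_) h
  · simpa using this
  · positivity

/-- `(1 − s)^{-2} ≤ 144` for `0 ≤ s ≤ 11/12`. [folklore] -/
theorem one_div_sq_le {s : ℝ} (hs : s ≤ 11 / 12) : 1 / (1 - s) ^ 2 ≤ 144 := by
  rw [div_le_iff₀ (by nlinarith)]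
  nlinarith

/-- `q^{-1/12} ≤ 11/12` for `q ≥ 3` (`(11/12)^{12} > 1/3`). [folklore] -/
theorem inv_rpow_twelfth_le {q : ℕ} (hq : 3 ≤ q) : ((q : ℝ)⁻¹) ^ (1 / 12 : ℝ) ≤ 11 / 12 := by
  have hq3 : (3 : ℝ) ≤ q := by exact_mod_cast hq
  have h1 : ((q : ℝ)⁻¹) ^ (1 / 12 : ℝ) ≤ ((3 : ℝ)⁻¹) ^ (1 / 12 : ℝ) :=
    Real.rpow_le_rpow (by positivity) (inv_anti₀ (by norm_num) hq3) (by norm_num)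
  refine h1.trans ?_
  by_contra h
  push Not at h
  have h12 := pow_lt_pow_left₀ h (by norm_num) (show (12 : ℕ) ≠ 0 by norm_num)
  rw [← Real.rpow_natCast (((3 : ℝ)⁻¹) ^ (1 / 12 : ℝ)) 12, ← Real.rpow_mul (by norm_num)] at h12
  norm_num at h12

/-- `(q^v)^{-7/12} ≤ y^{-3/2} · (q^{-1/12})^v` once `q^v > y³` (`q ≥ 1`, `y ≥ 1`). [folklore] -/
theorem inv_rpow_le_of_cube_lt {q v y : ℕ} (hq : 1 ≤ q) (hy : 1 ≤ y) (h : y ^ 3 < q ^ v) :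
    (((q : ℝ) ^ v)⁻¹) ^ (7 / 12 : ℝ) ≤ (y : ℝ) ^ (-(3 / 2 : ℝ)) * (((q : ℝ)⁻¹) ^ (1 / 12 : ℝ)) ^ v := by
  have hq0 : (0 : ℝ) < q := by exact_mod_cast hq
  have hy0 : (0 : ℝ) < y := by exact_mod_cast hy
  have ht0 : (0 : ℝ) < ((q : ℝ) ^ v)⁻¹ := by positivity
  have hty : ((q : ℝ) ^ v)⁻¹ ≤ ((y : ℝ) ^ 3)⁻¹ :=
    inv_anti₀ (by positivity) (by exact_mod_cast h.le)
  rw [show (7 / 12 : ℝ) = 1 / 2 + 1 / 12 by norm_num, Real.rpow_add ht0]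
  have h1 : (((q : ℝ) ^ v)⁻¹) ^ (1 / 2 : ℝ) ≤ (y : ℝ) ^ (-(3 / 2 : ℝ)) := by
    calc (((q : ℝ) ^ v)⁻¹) ^ (1 / 2 : ℝ) ≤ (((y : ℝ) ^ 3)⁻¹) ^ (1 / 2 : ℝ) :=
          Real.rpow_le_rpow ht0.le hty (by norm_num)
      _ = (y : ℝ) ^ (-(3 / 2 : ℝ)) := by
          rw [← Real.rpow_natCast (y : ℝ) 3, ← Real.rpow_neg hy0.le, ← Real.rpow_mul hy0.le]
          norm_num
  have h2 : (((q : ℝ) ^ v)⁻¹) ^ (1 / 12 : ℝ) = (((q : ℝ)⁻¹) ^ (1 / 12 : ℝ)) ^ v := by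
    rw [← inv_pow, ← Real.rpow_natCast ((q : ℝ)⁻¹) v, ← Real.rpow_mul (inv_nonneg.2 hq0.le), mul_comm,
      Real.rpow_mul (inv_nonneg.2 hq0.le), Real.rpow_natCast]
  rw [h2]
  exact mul_le_mul_of_nonneg_right h1 (pow_nonneg (Real.rpow_nonneg (inv_nonneg.2 hq0.le) _) _)

/-- A cell `q^v ≤ x` with `q ≥ 3` has `v ≤ log x`. [folklore] -/
theorem nat_le_log_of_pow_le {q v : ℕ} {x : ℝ} (hq : 3 ≤ q) (h : (q : ℝ) ^ v ≤ x) : (v : ℝ) ≤ Real.log x := by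
  have hq3 : (3 : ℝ) ≤ q := by exact_mod_cast hq
  have hqv : (0 : ℝ) < (q : ℝ) ^ v := by positivity
  have hlog : Real.log ((q : ℝ) ^ v) ≤ Real.log x := Real.log_le_log hqv h
  rw [Real.log_pow] at hlog
  have hlog3 : 1 ≤ Real.log q := by
    rw [Real.le_log_iff_exp_le (by linarith)]
    have := Real.exp_one_lt_d9
    linarith
  nlinarith [Nat.cast_nonneg (α := ℝ) v]

/-- `q^{v+1} > y⁴` with `1 ≤ q ≤ y` forces `q^v > y³`. [folklore] -/
theorem cube_lt_of_fourth_lt {q v y : ℕ} (hq : 1 ≤ q) (hqy : q ≤ y) (h : y ^ 4 < q ^ (v + 1)) :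
    y ^ 3 < q ^ v := by
  have hy : 0 < y := by omega
  have : y ^ 3 * y < q ^ v * y :=
    calc y ^ 3 * y = y ^ 4 := by ring
      _ < q ^ (v + 1) := h
      _ = q ^ v * q := by ring
      _ ≤ q ^ v * y := Nat.mul_le_mul_left _ hqy
  exact Nat.lt_of_mul_lt_mul_right this

end ValuationTailSum

open ValuationTailSum

/-- **The non-shallow cells carry small window-weighted mass.**  For `A, e > 0` and all large real `x`, with
`L = log x`, `y = ⌊L^{100000}⌋`: whenever a nonnegative cell function `cm` vanishes for primes `q > y` and for
`q^v > x` (`q ≥ 3` prime, `v ≥ 1`) and satisfies `cm q v ≤ A (L^{24} (q^v)^{-7/12} + x^{-2/5})` for `q^v ≤ x`,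
then for every finite set `T` of primes `≥ 3` and every `V`,
`Σ_{q ∈ T} Σ_{1 ≤ v ≤ V} [q^{v+1} > y⁴] (v+1) log q · cm q v ≤ e`. [folklore] -/
theorem valuation_tail_sum_small {A e : ℝ} (hA : 0 < A) (he : 0 < e) :
    ∀ᶠ x : ℝ in atTop, ∀ (cm : ℕ → ℕ → ℝ), (∀ q v : ℕ, 0 ≤ cm q v) →
      (∀ q v : ℕ, q.Prime → ⌊Real.log x ^ 100000⌋₊ < q → cm q v = 0) →
      (∀ q v : ℕ, q.Prime → 3 ≤ q → 1 ≤ v → (q : ℝ) ^ v ≤ x →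
        cm q v ≤ A * (Real.log x ^ 24 * (((q : ℝ) ^ v)⁻¹) ^ (7 / 12 : ℝ) + x⁻¹ ^ (2 / 5 : ℝ))) →
      (∀ q v : ℕ, q.Prime → 3 ≤ q → 1 ≤ v → x < (q : ℝ) ^ v → cm q v = 0) →
      ∀ (T : Finset ℕ), (∀ q ∈ T, q.Prime ∧ 3 ≤ q) → ∀ V : ℕ,
        ∑ q ∈ T, ∑ v ∈ Icc 1 V,
          (if q ^ (v + 1) ≤ ⌊Real.log x ^ 100000⌋₊ ^ 4 then 0 else ((v : ℝ) + 1) * Real.log q * cm q v) ≤ e := by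
  set c : ℝ := e / (8 * A * 100000) with hc
  have hc0 : 0 < c := by positivity
  have E2 : ∀ᶠ x : ℝ in atTop, 576 * A * 100000 / e ≤ Real.log x :=
    Real.tendsto_log_atTop.eventually_ge_atTop _
  have E3 := (isLittleO_log_rpow_rpow_atTop (((100000 + 3 : ℕ) : ℝ)) (show (0 : ℝ) < 2 / 5 by norm_num)).def hc0
  filter_upwards [polylog_regime_basic, E2, E3] with x hb hL hlo cm hcm0 hcmy hcmle hcmx T hT V
  obtain ⟨hx1, hL2, hy2, hyK', hyK, -, -, -, -, -, -⟩ := hb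
  set L : ℝ := Real.log x with hLdef
  set y : ℕ := ⌊L ^ 100000⌋₊ with hydef
  have hx0 : 0 < x := by linarith
  have hL1 : 1 ≤ L := by linarith
  have hL0 : 0 ≤ L := by linarith
  have hy1 : 1 ≤ y := by omega
  have hy2r : (2 : ℝ) ≤ y := by exact_mod_cast hy2
  have hy0 : (0 : ℝ) < y := by linarith
  -- the coefficients of the majorant
  set a : ℝ := A * L ^ 24 * (y : ℝ) ^ (-(3 / 2 : ℝ)) with ha
  set b : ℝ := A * x⁻¹ ^ (2 / 5 : ℝ) with hbdef
  have ha0 : 0 ≤ a := by positivity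
  have hb0 : 0 ≤ b := by positivity
  -- the majorant `g q v`
  have hterm : ∀ q ∈ T, ∀ v ∈ Icc 1 V,
      (if q ^ (v + 1) ≤ y ^ 4 then 0 else ((v : ℝ) + 1) * Real.log q * cm q v) ≤
        if q ≤ y then Real.log q * (a * (((v : ℝ) + 1) * (((q : ℝ)⁻¹) ^ (1 / 12 : ℝ)) ^ v) +
          b * (if v ≤ ⌊L⌋₊ then 2 * L else 0)) else 0 := by
    intro q hq v hv
    obtain ⟨hqp, hq3⟩ := hT q hq
    have hv1 : 1 ≤ v := (Finset.mem_Icc.1 hv).1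
    have hq3r : (3 : ℝ) ≤ q := by exact_mod_cast hq3
    have hlogq : 0 ≤ Real.log q := Real.log_nonneg (by linarith)
    have hs0 : 0 ≤ (((q : ℝ)⁻¹) ^ (1 / 12 : ℝ)) ^ v := pow_nonneg (Real.rpow_nonneg (by positivity) _) _
    have hvr : (0 : ℝ) ≤ v := Nat.cast_nonneg v
    by_cases hqy : q ≤ y
    · rw [if_pos hqy]
      have hg0 : 0 ≤ Real.log q * (a * (((v : ℝ) + 1) * (((q : ℝ)⁻¹) ^ (1 / 12 : ℝ)) ^ v) +
          b * (if v ≤ ⌊L⌋₊ then 2 * L else 0)) := by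
        refine mul_nonneg hlogq (add_nonneg (by positivity) (mul_nonneg hb0 ?_))
        split_ifs <;> linarith
      by_cases hsh : q ^ (v + 1) ≤ y ^ 4
      · rw [if_pos hsh]
        exact hg0
      · rw [if_neg hsh]
        push Not at hsh
        by_cases hxq : x < (q : ℝ) ^ v
        · rw [hcmx q v hqp hq3 hv1 hxq, mul_zero]
          exact hg0
        · push Not at hxq
          have hcube : y ^ 3 < q ^ v := cube_lt_of_fourth_lt (by omega) hqy hsh
          have h7 := inv_rpow_le_of_cube_lt (by omega) hy1 hcube
          have hvL : (v : ℝ) ≤ L := nat_le_log_of_pow_le hq3 hxq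
          have hvfl : v ≤ ⌊L⌋₊ := Nat.le_floor hvL
          rw [if_pos hvfl]
          have hcmb := hcmle q v hqp hq3 hv1 hxq
          have h2L : ((v : ℝ) + 1) ≤ 2 * L := by
            have : (1 : ℝ) ≤ v := by exact_mod_cast hv1
            linarith
          calc ((v : ℝ) + 1) * Real.log q * cm q v
              ≤ ((v : ℝ) + 1) * Real.log q *
                  (A * (L ^ 24 * (((q : ℝ) ^ v)⁻¹) ^ (7 / 12 : ℝ) + x⁻¹ ^ (2 / 5 : ℝ))) :=
                mul_le_mul_of_nonneg_left hcmb (by positivity)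
            _ = Real.log q * ((A * L ^ 24 * (((q : ℝ) ^ v)⁻¹) ^ (7 / 12 : ℝ)) * ((v : ℝ) + 1) +
                  b * ((v : ℝ) + 1)) := by rw [hbdef]; ring
            _ ≤ Real.log q * ((A * L ^ 24 * ((y : ℝ) ^ (-(3 / 2 : ℝ)) * (((q : ℝ)⁻¹) ^ (1 / 12 : ℝ)) ^ v)) *
                  ((v : ℝ) + 1) + b * (2 * L)) := by
                refine mul_le_mul_of_nonneg_left (add_le_add ?_ (mul_le_mul_of_nonneg_left h2L hb0)) hlogq
                exact mul_le_mul_of_nonneg_right (mul_le_mul_of_nonneg_left h7 (by positivity)) (by positivity)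
            _ = _ := by rw [ha]; ring
    · rw [if_neg hqy]
      push Not at hqy
      by_cases hsh : q ^ (v + 1) ≤ y ^ 4
      · rw [if_pos hsh]
      · rw [if_neg hsh, hcmy q v hqp hqy, mul_zero]
  -- sum the majorant over `v`
  have hinner : ∀ q ∈ T, ∑ v ∈ Icc 1 V,
      (if q ≤ y then Real.log q * (a * (((v : ℝ) + 1) * (((q : ℝ)⁻¹) ^ (1 / 12 : ℝ)) ^ v) +
          b * (if v ≤ ⌊L⌋₊ then 2 * L else 0)) else 0) ≤
        if q ≤ y then Real.log y * (a * 144 + b * (2 * L * L)) else 0 := by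
    intro q hq
    obtain ⟨-, hq3⟩ := hT q hq
    have hq3r : (3 : ℝ) ≤ q := by exact_mod_cast hq3
    by_cases hqy : q ≤ y
    · simp only [if_pos hqy]
      have hlogq : 0 ≤ Real.log q := Real.log_nonneg (by linarith)
      have hlogqy : Real.log q ≤ Real.log y := Real.log_le_log (by linarith) (by exact_mod_cast hqy)
      set s : ℝ := ((q : ℝ)⁻¹) ^ (1 / 12 : ℝ) with hs
      have hs0 : 0 ≤ s := Real.rpow_nonneg (by positivity) _
      have hs1 : s ≤ 11 / 12 := inv_rpow_twelfth_le hq3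
      have hS₁ : ∑ v ∈ Icc 1 V, ((v : ℝ) + 1) * s ^ v ≤ 144 :=
        (sum_Icc_succ_mul_pow_le hs0 (by linarith) V).trans (one_div_sq_le hs1)
      have hS₂ : ∑ v ∈ Icc 1 V, (if v ≤ ⌊L⌋₊ then 2 * L else (0 : ℝ)) ≤ 2 * L * L := by
        rw [← Finset.sum_filter, Finset.sum_const, nsmul_eq_mul]
        have hcard : (((Icc 1 V).filter (fun v => v ≤ ⌊L⌋₊)).card : ℝ) ≤ L := by
          have h1 : ((Icc 1 V).filter (fun v => v ≤ ⌊L⌋₊)).card ≤ (Icc 1 ⌊L⌋₊).card :=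
            Finset.card_le_card fun v hv => by
              rw [Finset.mem_filter, Finset.mem_Icc] at hv
              exact Finset.mem_Icc.2 ⟨hv.1.1, hv.2⟩
          rw [Nat.card_Icc] at h1
          calc (((Icc 1 V).filter (fun v => v ≤ ⌊L⌋₊)).card : ℝ) ≤ ⌊L⌋₊ := by exact_mod_cast (h1.trans (by omega))
            _ ≤ L := Nat.floor_le hL0
        nlinarith
      rw [← Finset.mul_sum, Finset.sum_add_distrib, ← Finset.mul_sum, ← Finset.mul_sum]
      exact mul_le_mul hlogqy (add_le_add (mul_le_mul_of_nonneg_left hS₁ ha0)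
        (mul_le_mul_of_nonneg_left hS₂ hb0)) (by positivity) (Real.log_nonneg (by linarith))
    · simp only [if_neg hqy, Finset.sum_const_zero, le_refl]
  -- sum over `q`: at most `y + 1` primes `q ≤ y` contribute
  set B : ℝ := Real.log y * (a * 144 + b * (2 * L * L)) with hB
  have hB0 : 0 ≤ B := mul_nonneg (Real.log_nonneg (by linarith)) (by positivity)
  have houter : ∑ q ∈ T, (if q ≤ y then B else 0) ≤ ((y : ℝ) + 1) * B := by
    rw [← Finset.sum_filter, Finset.sum_const, nsmul_eq_mul]
    refine mul_le_mul_of_nonneg_right ?_ hB0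
    have h1 : (T.filter (fun q => q ≤ y)).card ≤ (Finset.range (y + 1)).card :=
      Finset.card_le_card fun q hq => Finset.mem_range.2 (Nat.lt_succ_of_le (Finset.mem_filter.1 hq).2)
    rw [Finset.card_range] at h1
    exact_mod_cast h1
  -- the numerics: `(y+1) B ≤ e`
  have hlogy : Real.log y ≤ 100000 * L := by
    have h1 : Real.log y ≤ 100000 * Real.log L := by
      have h := Real.log_le_log hy0 hyK
      rwa [Real.log_pow] at h
    have h2 : Real.log L ≤ L := (Real.log_le_sub_one_of_pos (by linarith)).trans (by linarith)
    nlinarith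
  have hy60 : L ^ 60 ≤ y := by
    have hsplit : L ^ 100000 = L ^ 60 * L ^ 99940 := by rw [← pow_add]
    have hbig : 2 ≤ L ^ 99940 := hL2.trans (le_self_pow₀ hL1 (by norm_num))
    have : 2 * L ^ 60 ≤ L ^ 100000 := by rw [hsplit]; nlinarith [pow_nonneg hL0 60]
    linarith
  have hpart1 : 2 * (y : ℝ) * (100000 * L) * (a * 144) ≤ e / 2 := by
    -- `y · y^{-3/2} = y^{-1/2} ≤ L^{-30}`
    have hyy : (y : ℝ) * (y : ℝ) ^ (-(3 / 2 : ℝ)) = (y : ℝ) ^ (-(1 / 2 : ℝ)) := by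
      rw [show (-(1 / 2 : ℝ)) = 1 + -(3 / 2 : ℝ) by norm_num, Real.rpow_add hy0, Real.rpow_one]
    have hL60pos : 0 < L ^ 60 := by positivity
    have hyhalf : (y : ℝ) ^ (-(1 / 2 : ℝ)) ≤ (L ^ 30)⁻¹ := by
      calc (y : ℝ) ^ (-(1 / 2 : ℝ)) ≤ (L ^ 60) ^ (-(1 / 2 : ℝ)) :=
            Real.rpow_le_rpow_of_nonpos hL60pos hy60 (by norm_num)
        _ = (L ^ 30)⁻¹ := by
            rw [← Real.rpow_natCast L 60, ← Real.rpow_mul hL0,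
              show ((60 : ℕ) : ℝ) * (-(1 / 2 : ℝ)) = -((30 : ℕ) : ℝ) by norm_num, Real.rpow_neg hL0,
              Real.rpow_natCast]
    have hL30 : L ^ 25 * (L ^ 30)⁻¹ ≤ L⁻¹ := by
      rw [← one_div, ← one_div, ← div_eq_mul_one_div, div_le_div_iff₀ (by positivity) (by positivity), one_mul]
      calc L ^ 25 * L = L ^ 26 := by ring
        _ ≤ L ^ 30 := pow_le_pow_right₀ hL1 (by norm_num)
    have hfinal : 288 * A * 100000 * L⁻¹ ≤ e / 2 := by
      rw [← div_eq_mul_inv, div_le_iff₀ (by linarith)]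
      rw [div_le_iff₀ he] at hL
      nlinarith
    calc 2 * (y : ℝ) * (100000 * L) * (a * 144)
        = 288 * A * 100000 * (L ^ 25 * ((y : ℝ) * (y : ℝ) ^ (-(3 / 2 : ℝ)))) := by rw [ha]; ring
      _ ≤ 288 * A * 100000 * (L ^ 25 * (L ^ 30)⁻¹) := by
          rw [hyy]
          exact mul_le_mul_of_nonneg_left (mul_le_mul_of_nonneg_left hyhalf (by positivity)) (by positivity)
      _ ≤ 288 * A * 100000 * L⁻¹ := mul_le_mul_of_nonneg_left hL30 (by positivity)
      _ ≤ e / 2 := hfinal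
  have hpart2 : 2 * (y : ℝ) * (100000 * L) * (b * (2 * L * L)) ≤ e / 2 := by
    have hlo' : L ^ (100000 + 3) ≤ c * x ^ (2 / 5 : ℝ) := by
      rw [Real.rpow_natCast, Real.norm_of_nonneg (pow_nonneg hL0 _),
        Real.norm_of_nonneg (Real.rpow_nonneg hx0.le _)] at hlo
      exact hlo
    have hx25 : 0 < x ^ (2 / 5 : ℝ) := Real.rpow_pos_of_pos hx0 _
    have hkey : L ^ (100000 + 3) * x⁻¹ ^ (2 / 5 : ℝ) ≤ c := by
      rw [Real.inv_rpow hx0.le, ← div_eq_mul_inv, div_le_iff₀ hx25]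
      exact hlo'
    calc 2 * (y : ℝ) * (100000 * L) * (b * (2 * L * L))
        = 4 * A * 100000 * ((y : ℝ) * L ^ 3 * x⁻¹ ^ (2 / 5 : ℝ)) := by rw [hbdef]; ring
      _ ≤ 4 * A * 100000 * (L ^ 100000 * L ^ 3 * x⁻¹ ^ (2 / 5 : ℝ)) := by
          refine mul_le_mul_of_nonneg_left (mul_le_mul_of_nonneg_right
            (mul_le_mul_of_nonneg_right hyK (by positivity)) (by positivity)) (by positivity)
      _ = 4 * A * 100000 * (L ^ (100000 + 3) * x⁻¹ ^ (2 / 5 : ℝ)) := by rw [pow_add]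
      _ ≤ 4 * A * 100000 * c := mul_le_mul_of_nonneg_left hkey (by positivity)
      _ = e / 2 := by rw [hc]; field_simp; ring
  -- assemble
  calc ∑ q ∈ T, ∑ v ∈ Icc 1 V,
        (if q ^ (v + 1) ≤ y ^ 4 then 0 else ((v : ℝ) + 1) * Real.log q * cm q v)
      ≤ ∑ q ∈ T, ∑ v ∈ Icc 1 V,
          (if q ≤ y then Real.log q * (a * (((v : ℝ) + 1) * (((q : ℝ)⁻¹) ^ (1 / 12 : ℝ)) ^ v) +
            b * (if v ≤ ⌊L⌋₊ then 2 * L else 0)) else 0) :=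
        Finset.sum_le_sum fun q hq => Finset.sum_le_sum fun v hv => hterm q hq v hv
    _ ≤ ∑ q ∈ T, (if q ≤ y then B else 0) := Finset.sum_le_sum fun q hq => hinner q hq
    _ ≤ ((y : ℝ) + 1) * B := houter
    _ ≤ 2 * (y : ℝ) * (100000 * L) * (a * 144 + b * (2 * L * L)) := by
        rw [hB]
        have hy1r : (1 : ℝ) ≤ y := by exact_mod_cast hy1
        have h1 : ((y : ℝ) + 1) ≤ 2 * y := by linarith
        calc ((y : ℝ) + 1) * (Real.log y * (a * 144 + b * (2 * L * L)))
            ≤ (2 * y) * ((100000 * L) * (a * 144 + b * (2 * L * L))) :=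
              mul_le_mul h1 (mul_le_mul_of_nonneg_right hlogy (by positivity))
                (mul_nonneg (Real.log_nonneg (by linarith)) (by positivity)) (by positivity)
          _ = _ := by ring
    _ = 2 * (y : ℝ) * (100000 * L) * (a * 144) + 2 * (y : ℝ) * (100000 * L) * (b * (2 * L * L)) := by ring
    _ ≤ e / 2 + e / 2 := add_le_add hpart1 hpart2
    _ = e := by ring

end Literature.NumberTheory.Sieve

end
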